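import Summits.CriticalPhenomena.PercolationContinuityZ3.Theorems.PercNearOneGluingNoHeavyLowerTailQ7PsiGreen
import HarnessLib

/-!
# `NoHeavyLowerTail` (stmt-CriticalPhenomena-4575) — Kozma–Nitzan Question 7 for three relays when the
# observer is attached only to the relays and the target

Support file (`--supports stmt-CriticalPhenomena-4575`), coupling seat `prim-cplus-coupling` (gen 5).  No
definitions, no named facts, no sorries.

* `Q7Psi.q7_three_of_star` — **Theorem.**  In a finite weighted graph let `o, b, x, y, z` be distinct, every
  pair `s(o,u)` with `u ∉ {x, y, z, b}` of weight `0`, and `z` the least `b`-reliable of the relays: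
  `μ(z↔b) ≤ μ(x↔b)`, `μ(z↔b) ≤ μ(y↔b)`.  Then the pre-FKG inequality of Kozma–Nitzan's Question 7 (arXiv:2401.12397,
  p. 36) holds for the designated relay `z` and `A = {x,y,z}`:
  `μ({z↔b} ∩ {o↔A}) ≤ μ({o↔b} ∩ {o↔A})`.
  Kozma–Nitzan's Theorem 4 (pp. 12–14) gives the MIN version ("some relay") for observers attached only to
  relays; this is the designated version for three relays, with an `o–b` pair also allowed.  By the ttrl2 census
  (run/shared/lean/ttrl/tot3/RECIPES.md) this class contains every n = 5 instance left uncovered by the proved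
  regimes K/A/C/S/B and 55 % of the uncovered n = 6 instances.
  Proof: `Q7Psi.q7_of_psi` (the peeled form), the green bridge `Q7Psi.real_inter_openConn_eq_integral_green`
  (connection to `b` is the monotone cluster property `u` of `G ∖ b`), and `Q7Psi.gpsi_three_star` on `G ∖ b`
  (vertex type `{b}ᶜ`, weights restricted), whose hypotheses `E u(C z) ≤ E u(C x), E u(C y)` are the reliability
  hypotheses through the same bridge.
[cite: KozmaNitzan2024, Question 7 (p. 36), Theorem 4 and Lemma 5 (pp. 12–14), Lemma 3(ii) (pp. 6–7), §5.1 (pp. 31–32)]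
-/

namespace Summit.CriticalPhenomena.PercolationContinuityZ3.Theorems

open MeasureTheory Set Literature.Probability.LatticeModels Literature.Probability.Percolation
open scoped Classical
open KNPreFKG

noncomputable section

namespace Q7Psi

variable {V : Type*} [Fintype V]

/-- **Kozma–Nitzan's Question 7 for three relays, observer attached only to `A ∪ {b}`.**
[cite: KozmaNitzan2024, Question 7 (p. 36), Theorem 4 (pp. 12–14)] -/
theorem q7_three_of_star (w : Sym2 V → unitInterval) (o b x y z : V) (hob : o ≠ b)
    (hxo : x ≠ o) (hyo : y ≠ o) (hzo : z ≠ o) (hxb : x ≠ b) (hyb : y ≠ b) (hzb : z ≠ b)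
    (hxy : x ≠ y) (hxz : x ≠ z) (hyz : y ≠ z)
    (hiso : ∀ u, u ≠ o → u ∉ ({x, y, z, b} : Finset V) → w s(o, u) = 0)
    (hzx : (prodBernoulli w).real (openConn z b) ≤ (prodBernoulli w).real (openConn x b))
    (hzy : (prodBernoulli w).real (openConn z b) ≤ (prodBernoulli w).real (openConn y b)) :
    (prodBernoulli w).real (openConn z b ∩ (openConn o x ∪ openConn o y ∪ openConn o z)) ≤
      (prodBernoulli w).real (openConn o b ∩ (openConn o x ∪ openConn o y ∪ openConn o z)) := by
  set μ := prodBernoulli w with hμ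
  have hmeas : ∀ T : Set (BondConfig V), MeasurableSet T := fun _ => MeasurableSet.of_discrete
  -- (1) reduction to the peeled form
  have hA : ∀ X : Set (BondConfig V), X ∩ (⋃ a ∈ ({x, y, z} : Finset V), (openConn o a : Set (BondConfig V))) =
      X ∩ (openConn o x ∪ openConn o y ∪ openConn o z) := by
    intro X; congr 1; ext ω; simp [or_assoc]
  have hred := q7_of_psi w o b z ({x, y, z} : Finset V)
  rw [hA, hA] at hred
  refine hred ?_
  set Jx : Set (BondConfig V) := openConnIn ({b}ᶜ : Set V) o x with hJx
  set Jy : Set (BondConfig V) := openConnIn ({b}ᶜ : Set V) o y with hJy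
  set Jz : Set (BondConfig V) := openConnIn ({b}ᶜ : Set V) o z with hJz
  have hJ : ∀ X : Set (BondConfig V), X ∩ (⋃ a ∈ ({x, y, z} : Finset V), openConnIn ({b}ᶜ : Set V) o a) =
      X ∩ ((Jx ∪ Jy) ∪ Jz) := by
    intro X; congr 1; ext ω; simp [hJx, hJy, hJz, or_assoc]
  rw [hJ, hJ]
  -- (2) the `z`-part of the peeled event contributes equally to both sides
  have msplit : ∀ X : Set (BondConfig V), μ.real (X ∩ ((Jx ∪ Jy) ∪ Jz)) =
      μ.real (X ∩ (Jx ∪ Jy)) + μ.real (X ∩ Jz ∩ (Jx ∪ Jy)ᶜ) := by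
    intro X
    have hdj : Disjoint (X ∩ (Jx ∪ Jy)) (X ∩ Jz ∩ (Jx ∪ Jy)ᶜ) := by
      rw [Set.disjoint_left]
      rintro ω ⟨-, h⟩ ⟨-, hn⟩
      exact hn h
    rw [← measureReal_union hdj (hmeas _)]
    congr 1
    ext ω
    simp only [mem_inter_iff, mem_union, mem_compl_iff]
    tauto
  have hz_eq : openConn z b ∩ Jz ∩ (Jx ∪ Jy)ᶜ = openConn o b ∩ Jz ∩ (Jx ∪ Jy)ᶜ := by
    ext ω
    simp only [mem_inter_iff]
    constructor
    · rintro ⟨⟨hzb', hJ⟩, hn⟩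
      exact ⟨⟨(reachable_of_openConnIn hJ).trans hzb', hJ⟩, hn⟩
    · rintro ⟨⟨hob', hJ⟩, hn⟩
      exact ⟨⟨(reachable_of_openConnIn hJ).symm.trans hob', hJ⟩, hn⟩
  rw [msplit, msplit, hz_eq]
  suffices key : μ.real (openConn z b ∩ (Jx ∪ Jy)) ≤ μ.real (openConn o b ∩ (Jx ∪ Jy)) by linarith
  -- (3) pass to `G ∖ b`
  set S : Set V := {b}ᶜ with hS
  haveI : Fintype S := Fintype.ofFinite S
  set r := restrictConfig (Subtype.val : S → V) with hr
  set w' : Sym2 S → unitInterval := w ∘ Sym2.map (Subtype.val : S → V) with hw'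
  set μ' := prodBernoulli w' with hμ'
  set o' : S := ⟨o, mem_compl_singleton_iff.2 hob⟩ with ho'
  set x' : S := ⟨x, mem_compl_singleton_iff.2 hxb⟩ with hx'
  set y' : S := ⟨y, mem_compl_singleton_iff.2 hyb⟩ with hy'
  set z' : S := ⟨z, mem_compl_singleton_iff.2 hzb⟩ with hz'
  set E : Set (BondConfig S) := openConn o' x' ∪ openConn o' y' with hE
  have hJE : Jx ∪ Jy = r ⁻¹' E := by
    rw [hE, preimage_union, hr, preimage_openConn_val, preimage_openConn_val]
  -- the green function
  set F : Set S → ℝ := fun T => μ.real {ω₁ : BondConfig V | ∃ s ∈ Subtype.val '' T, s ≠ b ∧ s(b, s) ∈ ω₁} with hF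
  have hFmono : ∀ T T' : Set S, T ⊆ T' → F T ≤ F T' := by
    intro T T' hTT'
    refine measureReal_mono fun ω₁ hω₁ => ?_
    obtain ⟨s, hs, hsb, hso⟩ := hω₁
    exact ⟨s, image_mono hTT' hs, hsb, hso⟩
  have hbridge : ∀ (v : V) (hvb : v ≠ b) (E₁ : Set (BondConfig S)),
      μ.real (openConn v b ∩ r ⁻¹' E₁) = ∫ ω' in E₁, F (openCluster ω' ⟨v, mem_compl_singleton_iff.2 hvb⟩) ∂μ' := by
    intro v hvb E₁
    rw [inter_comm, hr, real_inter_openConn_eq_integral_green w b v hvb E₁, ← integral_indicator (hmeas _),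
      hμ', hw', ← integral_indicator (MeasurableSet.of_discrete), ← integral_comp_restrictConfig_val]
    refine integral_congr_ae (Filter.Eventually.of_forall fun ω => ?_)
    change (restrictConfig Subtype.val ⁻¹' E₁).indicator _ ω = E₁.indicator _ (restrictConfig Subtype.val ω)
    have hfun : (fun ω : BondConfig V => μ.real {ω₁ : BondConfig V | ∃ s ∈ {y | ω ∈ openConnIn ({b}ᶜ : Set V) v y},
        s ≠ b ∧ s(b, s) ∈ ω₁}) =
        (fun ω' => F (openCluster ω' ⟨v, mem_compl_singleton_iff.2 hvb⟩)) ∘ restrictConfig (Subtype.val : S → V) := by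
      funext ω
      simp only [Function.comp_apply, hF]
      rw [setOf_openConnIn_eq_image b ω ⟨v, mem_compl_singleton_iff.2 hvb⟩]
    rw [hfun]
    exact indicator_comp_right _
  -- the reliability hypotheses through the bridge (`E₁ = univ`)
  have htau : ∀ (v : V) (hvb : v ≠ b), μ.real (openConn v b) =
      ∫ ω', F (openCluster ω' ⟨v, mem_compl_singleton_iff.2 hvb⟩) ∂μ' := by
    intro v hvb
    rw [← setIntegral_univ, ← hbridge v hvb univ, preimage_univ, inter_univ]
  have hx'' : ∫ ω', F (openCluster ω' z') ∂μ' ≤ ∫ ω', F (openCluster ω' x') ∂μ' := by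
    rw [← htau z hzb, ← htau x hxb]; exact hzx
  have hy'' : ∫ ω', F (openCluster ω' z') ∂μ' ≤ ∫ ω', F (openCluster ω' y') ∂μ' := by
    rw [← htau z hzb, ← htau y hyb]; exact hzy
  have hxo' : x' ≠ o' := fun h => hxo (congrArg Subtype.val h)
  have hyo' : y' ≠ o' := fun h => hyo (congrArg Subtype.val h)
  have hzo' : z' ≠ o' := fun h => hzo (congrArg Subtype.val h)
  have hxy' : x' ≠ y' := fun h => hxy (congrArg Subtype.val h)
  have hxz' : x' ≠ z' := fun h => hxz (congrArg Subtype.val h)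
  have hyz' : y' ≠ z' := fun h => hyz (congrArg Subtype.val h)
  rw [hJE, hbridge z hzb E, hbridge o hob E]
  refine gpsi_three_star w' o' x' y' z' hxo' hyo' hzo' hxy' hxz' hyz' ?_ F hFmono hx'' hy''
  -- the star hypothesis on `G ∖ b`
  intro u huo hu
  have huo' : (u : V) ≠ o := fun h => huo (Subtype.ext h)
  have hub : (u : V) ≠ b := mem_compl_singleton_iff.1 u.2
  refine hiso u huo' ?_
  simp only [Finset.mem_insert, Finset.mem_singleton, not_or] at hu ⊢
  exact ⟨fun h => hu.1 (Subtype.ext h), fun h => hu.2.1 (Subtype.ext h), fun h => hu.2.2 (Subtype.ext h), hub⟩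

end Q7Psi

end

end Summit.CriticalPhenomena.PercolationContinuityZ3.Theorems
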